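import Summits.CriticalPhenomena.PercolationContinuityZ3.Theorems.Transplant.FKThreeApexT3EnvelopeAllQ
import Summits.CriticalPhenomena.PercolationContinuityZ3.Theorems.Transplant.FKConnectivityAllQEmbedding
import HarnessLib

/-!
# Every graph with a vertex cover of size `≤ 3` is Potts–Rayleigh on `(0,1]` — arbitrary finite vertex types

Support file (`--supports stmt-CriticalPhenomena-4575`), FK sub-lane `prim-bschramm-fk-3` (gen 18); builds on p205010 (kernel theorem,
internal audit signed; external expert review pending).  No named facts, no sorries; standard axioms.

`edgeNegCorrSupp_threeApex` (file `…T3EnvelopeAllQ`) is stated for a vertex type of cardinality exactly `n + 3`.  Here it is transported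
along the embedding of the finite set `{a,b,c} ∪ {u 0, …, u (n−1)}` into an arbitrary finite type `U` (`EdgeNegCorrSupp.image`):
**for three distinct vertices `a, b, c`, any `n` further distinct vertices `u j`, every `0 < q ≤ 1` and every weight vector supported on the
pairs `a u_j, b u_j, c u_j, ab, ac, bc`, every two distinct pairs are negatively correlated under `φ_{w,q}`** (`edgeNegCorrSupp_threeApexPairs`).
Since weight `0` deletes an edge, this is edge-negative association of `φ_{p,q}`, `0 < q ≤ 1`, on every finite graph with a vertex cover of
size at most three (e.g. `K₄`, `K₅⁻`, `K_{3,n}`, `K_{3,n}` plus edges inside the triple, `K₆ − E(K₃)`).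
[cite: Grimmett2006, §3.9 eq. (3.94), Conj. (3.96) (pp. 63–66)] [cite: Wagner2006, Conj. 5.3 (p. 13)]
-/

noncomputable section

namespace Summit.CriticalPhenomena.PercolationContinuityZ3.Theorems

namespace FK

namespace ThreeApex

open Literature.Probability.LatticeModels Literature.Probability.Percolation
open scoped Classical

variable {U : Type*} [Fintype U]

omit [Fintype U] in
/-- The three-apex pattern is transported by maps. [folklore] -/
theorem image_fullPairs {W : Type*} (f : W → U) (a b c : W) (v : ℕ → W) (n : ℕ) :
    Sym2.map f '' (↑(fullPairs a b c v n) : Set (Sym2 W)) = ↑(fullPairs (f a) (f b) (f c) (f ∘ v) n) := by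
  ext e
  simp only [Set.mem_image, Finset.mem_coe, mem_fullPairs_iff, mem_apexPairs_iff, mem_triPairs_iff, Function.comp_apply]
  constructor
  · rintro ⟨g, hg, rfl⟩
    rcases hg with ⟨j, hj, h⟩ | h
    · left; refine ⟨j, hj, ?_⟩
      rcases h with rfl | rfl | rfl <;> simp
    · right
      rcases h with rfl | rfl | rfl <;> simp
  · rintro (⟨j, hj, h⟩ | h)
    · rcases h with rfl | rfl | rfl
      · exact ⟨s(a, v j), Or.inl ⟨j, hj, Or.inl rfl⟩, by simp⟩
      · exact ⟨s(b, v j), Or.inl ⟨j, hj, Or.inr (Or.inl rfl)⟩, by simp⟩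
      · exact ⟨s(c, v j), Or.inl ⟨j, hj, Or.inr (Or.inr rfl)⟩, by simp⟩
    · rcases h with rfl | rfl | rfl
      · exact ⟨s(a, b), Or.inr (Or.inl rfl), by simp⟩
      · exact ⟨s(a, c), Or.inr (Or.inr (Or.inl rfl)), by simp⟩
      · exact ⟨s(b, c), Or.inr (Or.inr (Or.inr rfl)), by simp⟩

omit [Fintype U] in
/-- The pattern only sees the leaf map below `n`. [folklore] -/
theorem fullPairs_congr (a b c : U) {v v' : ℕ → U} (n : ℕ) (h : ∀ j, j < n → v j = v' j) :
    fullPairs a b c v n = fullPairs a b c v' n := by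
  ext e
  simp only [mem_fullPairs_iff, mem_apexPairs_iff]
  constructor
  · rintro (⟨j, hj, he⟩ | he)
    · exact Or.inl ⟨j, hj, by rwa [← h j hj]⟩
    · exact Or.inr he
  · rintro (⟨j, hj, he⟩ | he)
    · exact Or.inl ⟨j, hj, by rwa [h j hj]⟩
    · exact Or.inr he

/-- **EVERY WEIGHTED GRAPH WITH A VERTEX COVER OF SIZE `≤ 3` IS POTTS–RAYLEIGH ON `(0,1]`** (arbitrary finite vertex type): for distinct
`a, b, c`, leaves `u 0, …, u (n−1)` pairwise distinct and different from the apices, and `0 < q ≤ 1`, the random-cluster measure `φ_{w,q}`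
of every weight vector supported on the three-apex pattern is edge-negatively associated. (transcription of bschramm/prim-bschramm-fk-3/T3-HARMONIC.md §0)
[cite: Grimmett2006, §3.9 eq. (3.94), Conj. (3.96) (pp. 63–66)] [cite: Wagner2006, Conj. 5.3 (p. 13)] -/
theorem edgeNegCorrSupp_threeApexPairs {q : ℝ} (hq0 : 0 < q) (hq1 : q ≤ 1) (a b c : U) (u : ℕ → U) {n : ℕ}
    (hab : a ≠ b) (hac : a ≠ c) (hbc : b ≠ c) (hinj : ∀ j k, j < n → k < n → u j = u k → j = k)
    (hua : ∀ j, j < n → u j ≠ a) (hub : ∀ j, j < n → u j ≠ b) (huc : ∀ j, j < n → u j ≠ c) :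
    EdgeNegCorrSupp (↑(fullPairs a b c u n) : Set (Sym2 U)) q := by
  -- the vertex set of the pattern as a type of cardinality `n + 3`
  set L : Finset U := (Finset.range n).image u with hL
  set T : Finset U := insert a (insert b (insert c L)) with hT
  have haL : a ∉ L := by
    intro hm; obtain ⟨j, hj, hju⟩ := Finset.mem_image.1 hm; exact hua j (Finset.mem_range.1 hj) hju
  have hbL : b ∉ L := by
    intro hm; obtain ⟨j, hj, hju⟩ := Finset.mem_image.1 hm; exact hub j (Finset.mem_range.1 hj) hju
  have hcL : c ∉ L := by
    intro hm; obtain ⟨j, hj, hju⟩ := Finset.mem_image.1 hm; exact huc j (Finset.mem_range.1 hj) hju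
  have hLcard : L.card = n := by
    rw [hL, Finset.card_image_of_injOn, Finset.card_range]
    intro j hj k hk hjk
    exact hinj j k (Finset.mem_range.1 (Finset.mem_coe.1 hj)) (Finset.mem_range.1 (Finset.mem_coe.1 hk)) hjk
  have hcardT : T.card = n + 3 := by
    have h3 : c ∉ L := hcL
    have h2 : b ∉ insert c L := by simp [hbc, hbL]
    have h1 : a ∉ insert b (insert c L) := by simp [hab, hac, haL]
    rw [hT, Finset.card_insert_of_notMem h1, Finset.card_insert_of_notMem h2, Finset.card_insert_of_notMem h3, hLcard]
  have haT : a ∈ T := Finset.mem_insert_self a _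
  have hbT : b ∈ T := Finset.mem_insert_of_mem (Finset.mem_insert_self b _)
  have hcT : c ∈ T := Finset.mem_insert_of_mem (Finset.mem_insert_of_mem (Finset.mem_insert_self c _))
  -- leaves inside `T`: use `u j` for `j < n`, and the apex `a`'s slot is never needed for `j ≥ n`
  let x : ↥T := ⟨a, haT⟩
  let y : ↥T := ⟨b, hbT⟩
  let z : ↥T := ⟨c, hcT⟩
  let v : ℕ → ↥T := fun i => if h : i < n then ⟨u i, Finset.mem_insert_of_mem (Finset.mem_insert_of_mem
      (Finset.mem_insert_of_mem (Finset.mem_image_of_mem u (Finset.mem_range.2 h))))⟩ else x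
  have hcard : Fintype.card ↥T = n + 3 := by rw [Fintype.card_coe, hcardT]
  have hv_val : ∀ j, j < n → ((v j : ↥T) : U) = u j := by
    intro j hj; simp [v, hj]
  have hxy : x ≠ y := fun h => hab (congrArg Subtype.val h)
  have hxz : x ≠ z := fun h => hac (congrArg Subtype.val h)
  have hyz : y ≠ z := fun h => hbc (congrArg Subtype.val h)
  have hinj' : ∀ j k, j < n → k < n → v j = v k → j = k := by
    intro j k hj hk hjk
    have := congrArg Subtype.val hjk
    rw [hv_val j hj, hv_val k hk] at this
    exact hinj j k hj hk this
  have hva : ∀ j, j < n → v j ≠ x := by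
    intro j hj h; have := congrArg Subtype.val h; rw [hv_val j hj] at this; exact hua j hj this
  have hvb : ∀ j, j < n → v j ≠ y := by
    intro j hj h; have := congrArg Subtype.val h; rw [hv_val j hj] at this; exact hub j hj this
  have hvc : ∀ j, j < n → v j ≠ z := by
    intro j hj h; have := congrArg Subtype.val h; rw [hv_val j hj] at this; exact huc j hj this
  have key := edgeNegCorrSupp_threeApex (V := ↥T) (a := x) (b := y) (c := z) (v := v) (n := n)
    hxy hxz hyz hinj' hva hvb hvc hq0 hq1 hcard
  have img := EdgeNegCorrSupp.image (Function.Embedding.subtype (· ∈ T)) hq0 key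
  rw [image_fullPairs] at img
  have hxval : (Function.Embedding.subtype (· ∈ T)) x = a := rfl
  have hyval : (Function.Embedding.subtype (· ∈ T)) y = b := rfl
  have hzval : (Function.Embedding.subtype (· ∈ T)) z = c := rfl
  have hv : ∀ j, j < n → ((Function.Embedding.subtype (· ∈ T)) ∘ v) j = u j := by
    intro j hj
    simp only [Function.comp_apply, Function.Embedding.coe_subtype]
    exact hv_val j hj
  rwa [hxval, hyval, hzval, fullPairs_congr a b c n hv] at img

end ThreeApex

end FK

end Summit.CriticalPhenomena.PercolationContinuityZ3.Theorems
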